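import Summits.Parity.GeneralizedHardyLittlewood.Theorems.LeeYangFibresRelativeDimOneSplitEulerExpansion
import Summits.Parity.GeneralizedHardyLittlewood.Theorems.LeeYangFibresRelativeDimOneSingularTail
import Mathlib.Analysis.SpecialFunctions.Pow.Real
import HarnessLib

/-!
# Route `LeeYangFibres`, crux `RelativeDimOne` (stmt-Parity-14113), line `gallagher-backwards-split`:
# the registered stub `stub_singularSeriesBandlimited` (the singular series is incidence-bandlimited)

We prove `SingularSeriesBandlimited θ` for every `θ > 0` (vocabulary `LeeYangFibresRelativeDimOneSplitDefs`): for all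
`t, L, ε > 0` there is `N₀` such that for `N ≥ N₀` SOME level-`⌊N^θ⌋` incidence spectrum `g` (in fact one `g` for
all `N`: the singular-series spectrum `g(q, a, τ) = μ²(q) ∏_{p ∣ q} (β_p - 1)` of
`…SplitEulerExpansion.exists_singSpec`) satisfies `|𝔖(Ψ) - bandSum ⌊N^θ⌋ g (a, b)| ≤ ε` for every
non-degenerate `d = 1` system `Ψ = (a_i n + b_i)_i` with `‖Ψ‖_N ≤ L`.

Proof (Gallagher 1976, §2, with Green–Tao's local factors; all bounds uniform in `Ψ`):
* EXPANSION (`…SplitEulerExpansion`): for `x ≥ Q = ⌊N^θ⌋`,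
  `∏_{p ≤ x} β_p - Σ_{q ≤ Q sqfree} ∏_{p∣q}(β_p - 1) = Σ_{U ⊆ {p ≤ x}, ∏U > Q} ∏_{p∈U}(β_p - 1)`.
* RANKIN (`abs_sum_powerset_filter_le`): since `∏ U > Q ≥ N^θ - 1`, the tail is at most
  `N^{-θ/2} Σ_U ∏_{p ∈ U} √p |β_p - 1| = N^{-θ/2} ∏_{p ≤ x} (1 + √p |β_p - 1|) ≤ N^{-θ/2} exp(Σ_{p ≤ x} √p |β_p - 1|)`.
* THE WEIGHTED SUM (`sum_weight_le`), with `y = y(t, L, θ)` a CONSTANT: primes `p ≤ y` give `≤ (y+1) √y 2^t`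
  (`0 ≤ β_p ≤ 2^t`); primes `p > y ≥ max(L, 2t)` have `p ∤ a_i`, and either `p` is generic (`p ∤ D_ik` for all
  `i ≠ k`; `|β_p - 1| ≤ t²/p²`, `abs_localFactor_sub_one_le_of_generic`), total `≤ t² Σ_n n^{-3/2}`, or `p` divides
  some `0 < |D_ik| ≤ 2L²N` (`|β_p - 1| ≤ 4t/p`, `abs_localFactor_sub_one_le_of_coeff`; at most `t² log(2L²N)/log y`
  such primes, `card_filter_not_generic_le`), total `≤ (4t³/√y) log(2L²N) ≤ (θ/8)(log(2L²+1) + log N)` once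
  `√y ≥ 32 t³/θ`. Hence `Σ_{p ≤ x} √p |β_p - 1| ≤ C(t,L,θ) + (θ/8) log N`, the tail is
  `≤ exp(C' - (3θ/8) log N) ≤ ε` for `N ≥ N₀`, uniformly in `x ≥ Q`, and `x → ∞` (Lemma 1.3,
  `tendsto_singularProductPartial_holds`) gives `|𝔖(Ψ) - Σ_{q ≤ Q sqfree} ∏_{p∣q}(β_p - 1)| ≤ ε`
  (`abs_sub_sum_squarefree_le`). Finally `bandSum Q g = Σ_{q ≤ Q sqfree} ∏_{p∣q}(β_p - 1)` (`bandSum_eq_sum_squarefree`).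

References: Gallagher, Mathematika 23 (1976), §2 [Gallagher1976]; Green–Tao, Ann. of Math. 171 (2010), Lemma 1.3,
(1.6)–(1.7) [GreenTao2010].
-/

noncomputable section

open scoped BigOperators Topology
open Finset Filter Literature.NumberTheory.Sieve

namespace Summit.Parity.GeneralizedHardyLittlewood.Cruxes.RelativeDimOne.GallagherBackwardsSplit

namespace BandlimitedProof

open EulerExpansion
open Summit.Parity.GeneralizedHardyLittlewood.Cruxes.RelativeDimOne.TranslateAmplification.SingularTailProof
  (coeff_ne_zero crossDisc_ne_zero natAbs_crossDisc_le abs_localFactor_sub_one_le_of_generic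
    abs_localFactor_sub_one_le_of_coeff card_filter_not_generic_le)

variable {T : ℕ}

/-! ## Rankin's trick on the Euler tail -/

/-- `√(∏_{p ∈ U} p) = ∏_{p ∈ U} √p`. [folklore] -/
theorem sqrt_natCast_prod (U : Finset ℕ) : Real.sqrt ((∏ p ∈ U, p : ℕ) : ℝ) = ∏ p ∈ U, Real.sqrt p := by
  rw [Nat.cast_prod, Real.sqrt_eq_rpow, ← Real.finsetProd_rpow _ _ fun p _ => Nat.cast_nonneg p]
  exact Finset.prod_congr rfl fun p _ => (Real.sqrt_eq_rpow _).symm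

/-- RANKIN'S TRICK with exponent `1/2`: if `0 < R ≤ Q + 1` then
`|Σ_{U ⊆ S, ∏U > Q} ∏_{p ∈ U} f(p)| ≤ R^{-1/2} ∏_{p ∈ S} (1 + √p |f(p)|)` (insert `(∏U / R)^{1/2} ≥ 1`, drop the
condition, refactor with `Finset.prod_one_add`). [cite: Gallagher1976, Section 2] -/
theorem abs_sum_powerset_filter_le (S : Finset ℕ) (f : ℕ → ℝ) {R : ℝ} (hR : 0 < R) {Q : ℕ} (hRQ : R ≤ Q + 1) :
    |∑ U ∈ S.powerset.filter (fun U => ¬(∏ p ∈ U, p ≤ Q)), ∏ p ∈ U, f p| ≤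
      (∏ p ∈ S, (1 + Real.sqrt p * |f p|)) / Real.sqrt R := by
  have hR' : 0 < Real.sqrt R := Real.sqrt_pos.mpr hR
  have hnn : ∀ U : Finset ℕ, 0 ≤ ∏ p ∈ U, (Real.sqrt p * |f p|) := fun U =>
    Finset.prod_nonneg fun p _ => mul_nonneg (Real.sqrt_nonneg _) (abs_nonneg _)
  calc |∑ U ∈ S.powerset.filter (fun U => ¬(∏ p ∈ U, p ≤ Q)), ∏ p ∈ U, f p|
      ≤ ∑ U ∈ S.powerset.filter (fun U => ¬(∏ p ∈ U, p ≤ Q)), |∏ p ∈ U, f p| := Finset.abs_sum_le_sum_abs _ _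
    _ ≤ ∑ U ∈ S.powerset.filter (fun U => ¬(∏ p ∈ U, p ≤ Q)), (∏ p ∈ U, (Real.sqrt p * |f p|)) / Real.sqrt R := by
        refine Finset.sum_le_sum fun U hU => ?_
        have hbig : R ≤ ((∏ p ∈ U, p : ℕ) : ℝ) := by
          have h1 : Q < ∏ p ∈ U, p := not_le.mp (Finset.mem_filter.mp hU).2
          calc R ≤ (Q : ℝ) + 1 := hRQ
            _ ≤ _ := by exact_mod_cast h1
        have hsq : Real.sqrt R ≤ ∏ p ∈ U, Real.sqrt p := by
          rw [← sqrt_natCast_prod]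
          exact Real.sqrt_le_sqrt hbig
        have h0 : 0 ≤ ∏ p ∈ U, |f p| := Finset.prod_nonneg fun p _ => abs_nonneg _
        rw [Finset.abs_prod, le_div_iff₀ hR', Finset.prod_mul_distrib]
        calc (∏ p ∈ U, |f p|) * Real.sqrt R ≤ (∏ p ∈ U, |f p|) * ∏ p ∈ U, Real.sqrt p :=
              mul_le_mul_of_nonneg_left hsq h0
          _ = (∏ p ∈ U, Real.sqrt p) * ∏ p ∈ U, |f p| := mul_comm _ _
    _ ≤ ∑ U ∈ S.powerset, (∏ p ∈ U, (Real.sqrt p * |f p|)) / Real.sqrt R :=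
        Finset.sum_le_sum_of_subset_of_nonneg (Finset.filter_subset _ _) fun U _ _ => div_nonneg (hnn U) hR'.le
    _ = (∏ p ∈ S, (1 + Real.sqrt p * |f p|)) / Real.sqrt R := by
        rw [← Finset.sum_div, Finset.prod_one_add]

/-! ## The weighted local-factor sum `Σ_{p ≤ x} √p |β_p − 1|` -/

/-- CRUDE BOUND at the small primes: `√p |β_p - 1| ≤ √y · 2^T` for a prime `p ≤ y` (`0 ≤ β_p ≤ (p/(p-1))^T ≤ 2^T`).
[cite: GreenTao2010, proof of Lemma 1.3] -/
theorem weight_le_crude (Φ : Fin T → AffLinForm 1) {p y : ℕ} (hp : p.Prime) (hpy : p ≤ y) :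
    Real.sqrt p * |localFactor Φ p - 1| ≤ Real.sqrt y * 2 ^ T := by
  have hβ0 := localFactor_nonneg Φ p
  have hβ1 : localFactor Φ p ≤ 2 ^ T := (localFactor_prime_le Φ hp).trans (div_pred_pow_le_two_pow hp.two_le T)
  have h2T : (1 : ℝ) ≤ 2 ^ T := one_le_pow₀ (by norm_num)
  have h1 : |localFactor Φ p - 1| ≤ 2 ^ T := by
    rw [abs_le]
    constructor <;> linarith
  exact mul_le_mul (Real.sqrt_le_sqrt (by exact_mod_cast hpy)) h1 (abs_nonneg _) (Real.sqrt_nonneg _)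

/-- Small primes: `Σ_{p ≤ y} √p |β_p - 1| ≤ (y + 1) √y 2^T`. [cite: GreenTao2010, proof of Lemma 1.3] -/
theorem sum_weight_primesLE_le (Φ : Fin T → AffLinForm 1) (y : ℕ) :
    ∑ p ∈ Nat.primesLE y, Real.sqrt p * |localFactor Φ p - 1| ≤ ((y : ℝ) + 1) * (Real.sqrt y * 2 ^ T) := by
  calc ∑ p ∈ Nat.primesLE y, Real.sqrt p * |localFactor Φ p - 1|
      ≤ ∑ p ∈ Nat.primesLE y, Real.sqrt y * 2 ^ T :=
        Finset.sum_le_sum fun p hp => weight_le_crude Φ (Nat.prime_of_mem_primesLE hp) (Nat.le_of_mem_primesLE hp)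
    _ = #(Nat.primesLE y) * (Real.sqrt y * 2 ^ T) := by rw [Finset.sum_const, nsmul_eq_mul]
    _ ≤ ((y : ℝ) + 1) * (Real.sqrt y * 2 ^ T) := by
        refine mul_le_mul_of_nonneg_right ?_ (by positivity)
        have : #(Nat.primesLE y) ≤ y + 1 := by
          rw [Nat.primesLE_eq_filter_range]
          exact (Finset.card_filter_le _ _).trans (Finset.card_range _).le
        exact_mod_cast this

/-- `√p · (c/p²) = c p^{-3/2}`. [folklore] -/
theorem sqrt_mul_div_sq {p : ℝ} (hp : 0 < p) (c : ℝ) : Real.sqrt p * (c / p ^ 2) = c * p ^ (-(3 / 2 : ℝ)) := by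
  rw [Real.sqrt_eq_rpow, show (-(3 / 2 : ℝ)) = 1 / 2 - 2 by norm_num, Real.rpow_sub hp, Real.rpow_two]
  ring

/-- LARGE PRIMES: for a non-degenerate one-dimensional system with `‖Φ‖_N ≤ L` and `y ≥ max(2, L, 2T)`, for every `x`,
`Σ_{y < p ≤ x} √p |β_p - 1| ≤ T² Σ_n n^{-3/2} + (4T/√y) · T² log(2L²N)/log y`: generic primes contribute
`√p · T²/p² = T² p^{-3/2}`, the others `√p · 4T/p ≤ 4T/√y` each and number `≤ T² log(2L²N)/log y`.
[cite: GreenTao2010, Lemma 1.3] -/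
theorem sum_weight_sdiff_le (Φ : Fin T → AffLinForm 1) (hΦ : IsNondegenerateSystem Φ) {N L y : ℕ} (hN : 0 < N)
    (hL : affLinSize Φ N ≤ L) (hy2 : 2 ≤ y) (hyL : L ≤ y) (hyT : 2 * T ≤ y) (x : ℕ) :
    ∑ p ∈ Nat.primesLE x \ Nat.primesLE y, Real.sqrt p * |localFactor Φ p - 1| ≤
      (T : ℝ) ^ 2 * (∑' n : ℕ, (n : ℝ) ^ (-(3 / 2 : ℝ))) +
        4 * T / Real.sqrt y * ((T : ℝ) ^ 2 * (Real.log ((2 * L ^ 2 * N : ℕ) : ℝ) / Real.log y)) := by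
  classical
  set PR := Nat.primesLE x \ Nat.primesLE y with hPR
  set D : Fin T → Fin T → ℕ := fun i k => ((Φ i).coeff 0 * (Φ k).const - (Φ k).coeff 0 * (Φ i).const).natAbs
    with hDdef
  have hmem : ∀ p ∈ PR, p.Prime ∧ y < p ∧ p ≤ x := by
    intro p hp
    obtain ⟨hp1, hp2⟩ := Finset.mem_sdiff.mp hp
    rw [Nat.mem_primesLE] at hp1 hp2
    exact ⟨hp1.2, by by_contra hh; exact hp2 ⟨by omega, hp1.2⟩, hp1.1⟩
  have hy0 : (0 : ℝ) < y := by exact_mod_cast (by omega : 0 < y)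
  have hsy : 0 < Real.sqrt y := Real.sqrt_pos.mpr hy0
  have hsum : Summable (fun n : ℕ => (n : ℝ) ^ (-(3 / 2 : ℝ))) := Real.summable_nat_rpow.mpr (by norm_num)
  have hA : ∀ p ∈ PR, ∀ i, (((Φ i).coeff 0 : ℤ) : ZMod p) ≠ 0 := fun p hp i =>
    intCast_zmod_ne_zero_of_natAbs_lt (coeff_ne_zero hΦ i)
      (lt_of_le_of_lt ((natAbs_coeff_le_of_affLinSize_le hL i 0).trans hyL) (hmem p hp).2.1)
  rw [← Finset.sum_filter_add_sum_filter_not PR (fun p => ∀ i k, i ≠ k → ¬p ∣ D i k)]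
  refine add_le_add ?_ ?_
  · -- generic primes
    calc ∑ p ∈ PR.filter (fun p => ∀ i k, i ≠ k → ¬p ∣ D i k), Real.sqrt p * |localFactor Φ p - 1|
        ≤ ∑ p ∈ PR.filter (fun p => ∀ i k, i ≠ k → ¬p ∣ D i k), (T : ℝ) ^ 2 * (p : ℝ) ^ (-(3 / 2 : ℝ)) := by
          refine Finset.sum_le_sum fun p hp => ?_
          obtain ⟨hp1, hp2⟩ := Finset.mem_filter.mp hp
          have hp0 : (0 : ℝ) < p := by exact_mod_cast (hmem p hp1).1.pos
          rw [← sqrt_mul_div_sq hp0]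
          refine mul_le_mul_of_nonneg_left ?_ (Real.sqrt_nonneg _)
          refine abs_localFactor_sub_one_le_of_generic Φ (hmem p hp1).1 (hA p hp1) (fun i k hik hz => hp2 i k hik ?_)
            (by have := (hmem p hp1).2.1; omega)
          exact Int.natCast_dvd.mp ((ZMod.intCast_zmod_eq_zero_iff_dvd _ p).mp hz)
      _ ≤ ∑ p ∈ PR, (T : ℝ) ^ 2 * (p : ℝ) ^ (-(3 / 2 : ℝ)) :=
          Finset.sum_le_sum_of_subset_of_nonneg (Finset.filter_subset _ _) fun p _ _ => by positivity
      _ = (T : ℝ) ^ 2 * ∑ p ∈ PR, (p : ℝ) ^ (-(3 / 2 : ℝ)) := (Finset.mul_sum _ _ _).symm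
      _ ≤ (T : ℝ) ^ 2 * ∑' n : ℕ, (n : ℝ) ^ (-(3 / 2 : ℝ)) :=
          mul_le_mul_of_nonneg_left (hsum.sum_le_tsum PR fun n _ => by positivity) (by positivity)
  · -- the non-generic primes
    calc ∑ p ∈ PR.filter (fun p => ¬∀ i k, i ≠ k → ¬p ∣ D i k), Real.sqrt p * |localFactor Φ p - 1|
        ≤ ∑ p ∈ PR.filter (fun p => ¬∀ i k, i ≠ k → ¬p ∣ D i k), 4 * (T : ℝ) / Real.sqrt y := by
          refine Finset.sum_le_sum fun p hp => ?_
          obtain ⟨hp1, -⟩ := Finset.mem_filter.mp hp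
          obtain ⟨hpp, hyp, -⟩ := hmem p hp1
          have hp0 : (0 : ℝ) < p := by exact_mod_cast hpp.pos
          have hsp : 0 < Real.sqrt p := Real.sqrt_pos.mpr hp0
          calc Real.sqrt p * |localFactor Φ p - 1| ≤ Real.sqrt p * (4 * T / p) :=
                mul_le_mul_of_nonneg_left (abs_localFactor_sub_one_le_of_coeff Φ hpp (hA p hp1) (by omega))
                  (Real.sqrt_nonneg _)
            _ = 4 * T / Real.sqrt p := by
                rw [eq_div_iff hsp.ne', mul_right_comm, Real.mul_self_sqrt hp0.le]
                field_simp
            _ ≤ 4 * T / Real.sqrt y :=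
                div_le_div_of_nonneg_left (by positivity) hsy (Real.sqrt_le_sqrt (by exact_mod_cast hyp.le))
      _ = #(PR.filter (fun p => ¬∀ i k, i ≠ k → ¬p ∣ D i k)) * (4 * (T : ℝ) / Real.sqrt y) := by
          rw [Finset.sum_const, nsmul_eq_mul]
      _ ≤ (T : ℝ) ^ 2 * (Real.log ((2 * L ^ 2 * N : ℕ) : ℝ) / Real.log y) * (4 * (T : ℝ) / Real.sqrt y) := by
          refine mul_le_mul_of_nonneg_right ?_ (by positivity)
          exact card_filter_not_generic_le D hy2
            (fun i k hik => ⟨Int.natAbs_pos.mpr (crossDisc_ne_zero hΦ hik), natAbs_crossDisc_le hN hL i k⟩)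
            PR (fun p hp => ⟨(hmem p hp).1, (hmem p hp).2.1⟩)
      _ = 4 * T / Real.sqrt y * ((T : ℝ) ^ 2 * (Real.log ((2 * L ^ 2 * N : ℕ) : ℝ) / Real.log y)) := by ring

/-- ALL PRIMES: `Σ_{p ≤ x} √p |β_p - 1| ≤ (y+1) √y 2^T + T² Σ_n n^{-3/2} + (4T/√y) T² log(2L²N)/log y`, uniformly in
`x` and in the non-degenerate `Φ` with `‖Φ‖_N ≤ L` (`y ≥ max(2, L, 2T)`). [cite: GreenTao2010, Lemma 1.3] -/
theorem sum_weight_le (Φ : Fin T → AffLinForm 1) (hΦ : IsNondegenerateSystem Φ) {N L y : ℕ} (hN : 0 < N)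
    (hL : affLinSize Φ N ≤ L) (hy2 : 2 ≤ y) (hyL : L ≤ y) (hyT : 2 * T ≤ y) (x : ℕ) :
    ∑ p ∈ Nat.primesLE x, Real.sqrt p * |localFactor Φ p - 1| ≤
      ((y : ℝ) + 1) * (Real.sqrt y * 2 ^ T) + ((T : ℝ) ^ 2 * (∑' n : ℕ, (n : ℝ) ^ (-(3 / 2 : ℝ))) +
        4 * T / Real.sqrt y * ((T : ℝ) ^ 2 * (Real.log ((2 * L ^ 2 * N : ℕ) : ℝ) / Real.log y))) := by
  have hsub : Nat.primesLE x ⊆ Nat.primesLE y ∪ (Nat.primesLE x \ Nat.primesLE y) := by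
    rw [Finset.union_sdiff_self_eq_union]
    exact Finset.subset_union_right
  calc ∑ p ∈ Nat.primesLE x, Real.sqrt p * |localFactor Φ p - 1|
      ≤ ∑ p ∈ Nat.primesLE y ∪ (Nat.primesLE x \ Nat.primesLE y), Real.sqrt p * |localFactor Φ p - 1| :=
        Finset.sum_le_sum_of_subset_of_nonneg hsub fun p _ _ => mul_nonneg (Real.sqrt_nonneg _) (abs_nonneg _)
    _ = ∑ p ∈ Nat.primesLE y, Real.sqrt p * |localFactor Φ p - 1| +
          ∑ p ∈ Nat.primesLE x \ Nat.primesLE y, Real.sqrt p * |localFactor Φ p - 1| :=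
        Finset.sum_union Finset.disjoint_sdiff
    _ ≤ _ := add_le_add (sum_weight_primesLE_le Φ y) (sum_weight_sdiff_le Φ hΦ hN hL hy2 hyL hyT x)

/-! ## The uniform Euler tail and the limit -/

/-- **UNIFORM EULER TAIL OF THE SINGULAR SERIES** (`d = 1`): for all `T, L`, `θ > 0`, `ε > 0` there is `N₀` such that
for `N ≥ N₀`, every non-degenerate `Φ : Fin T → AffLinForm 1` with `‖Φ‖_N ≤ L`, and `Q = ⌊N^θ⌋`:
`|∏_{p ≤ x} β_p - Σ_{q ≤ Q sqfree} ∏_{p ∣ q}(β_p - 1)| ≤ ε` for every `x ≥ Q`, and in the limit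
`|𝔖(Φ) - Σ_{q ≤ Q sqfree} ∏_{p ∣ q}(β_p - 1)| ≤ ε`. [cite: Gallagher1976, Section 2] -/
theorem abs_sub_sum_squarefree_le (T L : ℕ) {θ ε : ℝ} (hθ : 0 < θ) (hε : 0 < ε) :
    ∃ N₀ : ℕ, ∀ N : ℕ, N₀ ≤ N → ∀ Φ : Fin T → AffLinForm 1, IsNondegenerateSystem Φ → affLinSize Φ N ≤ L →
      (∀ x : ℕ, level θ N ≤ x →
        |singularProductPartial Φ x - ∑ q ∈ (Finset.Icc 1 (level θ N)).filter Squarefree,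
            ∏ p ∈ q.primeFactors, (localFactor Φ p - 1)| ≤ ε) ∧
      |singularProduct Φ - ∑ q ∈ (Finset.Icc 1 (level θ N)).filter Squarefree,
          ∏ p ∈ q.primeFactors, (localFactor Φ p - 1)| ≤ ε := by
  -- the constants: a fixed cut `y = y(T, L, θ)`, the constant part `C` of the weighted sum, the threshold `exp K`
  set y : ℕ := max (max 3 (max L (2 * T))) ⌈(32 * (T : ℝ) ^ 3 / θ) ^ 2⌉₊ with hy
  set C : ℝ := ((y : ℝ) + 1) * (Real.sqrt y * 2 ^ T) + (T : ℝ) ^ 2 * ∑' n : ℕ, (n : ℝ) ^ (-(3 / 2 : ℝ)) with hC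
  set Λ₀ : ℝ := Real.log (2 * (L : ℝ) ^ 2 + 1) with hΛ₀
  set K : ℝ := 8 / (3 * θ) * (C + θ / 8 * Λ₀ - Real.log ε) with hK
  refine ⟨max 1 ⌈Real.exp K⌉₊, fun N hN Φ hΦ hL => ?_⟩
  -- unpacking `N ≥ N₀`
  have hN1 : 1 ≤ N := le_trans (le_max_left _ _) hN
  have hNpos : 0 < N := hN1
  have hNr : (0 : ℝ) < N := by exact_mod_cast hNpos
  have hKN : K ≤ Real.log N := by
    rw [Real.le_log_iff_exp_le hNr]
    exact (Nat.le_ceil _).trans (by exact_mod_cast le_trans (le_max_right _ _) hN)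
  have hlogN0 : 0 ≤ Real.log N := Real.log_nonneg (by exact_mod_cast hN1)
  -- unpacking `y`
  have hy3 : 3 ≤ y := by omega
  have hy2 : 2 ≤ y := by omega
  have hyL : L ≤ y := by omega
  have hyT : 2 * T ≤ y := by omega
  have hyc : ⌈(32 * (T : ℝ) ^ 3 / θ) ^ 2⌉₊ ≤ y := by omega
  have hy0 : (0 : ℝ) < y := by exact_mod_cast (by omega : 0 < y)
  have hsy : 0 < Real.sqrt y := Real.sqrt_pos.mpr hy0
  have hlogy : 1 ≤ Real.log y := by
    rw [Real.le_log_iff_exp_le hy0]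
    have h3 : (3 : ℝ) ≤ y := by exact_mod_cast hy3
    linarith [Real.exp_one_lt_d9]
  have hsq : 32 * (T : ℝ) ^ 3 / θ ≤ Real.sqrt y :=
    Real.le_sqrt_of_sq_le ((Nat.le_ceil _).trans (by exact_mod_cast hyc))
  have hcoef : 4 * (T : ℝ) ^ 3 / Real.sqrt y ≤ θ / 8 := by
    rw [div_le_iff₀ hsy]
    have h1 := mul_le_mul_of_nonneg_left hsq (by positivity : (0 : ℝ) ≤ θ / 8)
    have e : θ / 8 * (32 * (T : ℝ) ^ 3 / θ) = 4 * (T : ℝ) ^ 3 := by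
      field_simp
      ring
    linarith
  -- `log(2 L² N) ≤ Λ₀ + log N`
  have hΛ₀0 : 0 ≤ Λ₀ := Real.log_nonneg (by nlinarith [sq_nonneg (L : ℝ)])
  have hH : Real.log ((2 * L ^ 2 * N : ℕ) : ℝ) ≤ Λ₀ + Real.log N := by
    rcases Nat.eq_zero_or_pos (2 * L ^ 2 * N) with h0 | hpos
    · rw [h0, Nat.cast_zero, Real.log_zero]
      positivity
    · calc Real.log ((2 * L ^ 2 * N : ℕ) : ℝ) ≤ Real.log ((2 * (L : ℝ) ^ 2 + 1) * N) := by
            refine Real.log_le_log (by exact_mod_cast hpos) ?_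
            push_cast
            nlinarith
        _ = Λ₀ + Real.log N := by rw [Real.log_mul (by positivity) hNr.ne']
  -- the uniform bound on the weighted sum, for every `x`
  have hE : ∀ x : ℕ, ∑ p ∈ Nat.primesLE x, Real.sqrt p * |localFactor Φ p - 1| ≤ C + θ / 8 * (Λ₀ + Real.log N) := by
    intro x
    have h1 := sum_weight_le Φ hΦ hNpos hL hy2 hyL hyT x
    have hlogH0 : 0 ≤ Real.log ((2 * L ^ 2 * N : ℕ) : ℝ) := Real.log_natCast_nonneg _
    have h3 : Real.log ((2 * L ^ 2 * N : ℕ) : ℝ) / Real.log y ≤ Λ₀ + Real.log N :=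
      (div_le_self hlogH0 hlogy).trans hH
    have h2 : 4 * (T : ℝ) / Real.sqrt y * ((T : ℝ) ^ 2 * (Real.log ((2 * L ^ 2 * N : ℕ) : ℝ) / Real.log y)) ≤
        θ / 8 * (Λ₀ + Real.log N) :=
      calc 4 * (T : ℝ) / Real.sqrt y * ((T : ℝ) ^ 2 * (Real.log ((2 * L ^ 2 * N : ℕ) : ℝ) / Real.log y))
          = 4 * (T : ℝ) ^ 3 / Real.sqrt y * (Real.log ((2 * L ^ 2 * N : ℕ) : ℝ) / Real.log y) := by ring
        _ ≤ θ / 8 * (Λ₀ + Real.log N) :=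
          mul_le_mul hcoef h3 (div_nonneg hlogH0 (by linarith)) (by positivity)
    rw [hC]
    linarith
  -- Rankin, for every `x ≥ Q`
  set B := ∑ q ∈ (Finset.Icc 1 (level θ N)).filter Squarefree, ∏ p ∈ q.primeFactors, (localFactor Φ p - 1)
    with hB
  have hR : 0 < (N : ℝ) ^ θ := Real.rpow_pos_of_pos hNr θ
  have hRQ : (N : ℝ) ^ θ ≤ (level θ N : ℝ) + 1 := by
    unfold level
    exact (Nat.lt_floor_add_one _).le
  have hsqrtR : Real.sqrt ((N : ℝ) ^ θ) = Real.exp (Real.log N * θ * (1 / 2)) := by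
    rw [Real.rpow_def_of_pos hNr, Real.sqrt_eq_rpow, ← Real.exp_mul]
  have htail : ∀ x : ℕ, level θ N ≤ x → |singularProductPartial Φ x - B| ≤ ε := by
    intro x hx
    rw [hB, singularProductPartial_sub_sum_squarefree Φ hx]
    refine (abs_sum_powerset_filter_le (Nat.primesLE x) (fun p => localFactor Φ p - 1) hR hRQ).trans ?_
    have hprod : ∏ p ∈ Nat.primesLE x, (1 + Real.sqrt p * |localFactor Φ p - 1|) ≤
        Real.exp (C + θ / 8 * (Λ₀ + Real.log N)) := by
      calc ∏ p ∈ Nat.primesLE x, (1 + Real.sqrt p * |localFactor Φ p - 1|)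
          ≤ Real.exp (∑ p ∈ Nat.primesLE x, Real.sqrt p * |localFactor Φ p - 1|) := by
            rw [Real.exp_sum]
            refine Finset.prod_le_prod (fun p _ => by positivity) fun p _ => ?_
            linarith [Real.add_one_le_exp (Real.sqrt p * |localFactor Φ p - 1|)]
        _ ≤ _ := Real.exp_le_exp.mpr (hE x)
    rw [div_le_iff₀ (Real.sqrt_pos.mpr hR), hsqrtR]
    refine hprod.trans ?_
    have hfinal : C + θ / 8 * (Λ₀ + Real.log N) ≤ Real.log ε + Real.log N * θ * (1 / 2) := by
      have h1 : 3 * θ / 8 * K ≤ 3 * θ / 8 * Real.log N := mul_le_mul_of_nonneg_left hKN (by positivity)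
      have h2 : 3 * θ / 8 * K = C + θ / 8 * Λ₀ - Real.log ε := by
        rw [hK]
        field_simp
      linarith
    calc Real.exp (C + θ / 8 * (Λ₀ + Real.log N)) ≤ Real.exp (Real.log ε + Real.log N * θ * (1 / 2)) :=
          Real.exp_le_exp.mpr hfinal
      _ = ε * Real.exp (Real.log N * θ * (1 / 2)) := by rw [Real.exp_add, Real.exp_log hε]
  -- the limit `x → ∞` (Lemma 1.3 for the non-degenerate system `Φ`)
  refine ⟨htail, ?_⟩
  have hlim : Tendsto (fun x => |singularProductPartial Φ x - B|) atTop (𝓝 |singularProduct Φ - B|) :=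
    (continuous_abs.tendsto _).comp ((tendsto_singularProductPartial_holds 1 T Φ hΦ).sub tendsto_const_nhds)
  exact le_of_tendsto hlim (Filter.eventually_atTop.mpr ⟨level θ N, htail⟩)

end BandlimitedProof

open EulerExpansion BandlimitedProof in
/-- **`stub_singularSeriesBandlimited`** (registered stub of the line `gallagher-backwards-split`): THE SINGULAR SERIES IS
INCIDENCE-BANDLIMITED at every power level `N^θ`, `θ > 0`, uniformly — eventually in `N`, the singular-series
spectrum `g(q, a, τ) = μ²(q) ∏_{p ∣ q} (β_p - 1)` (`exists_singSpec`; it sees the shifts only through the incidence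
type) has `|𝔖(Ψ) - bandSum ⌊N^θ⌋ g (a, b)| ≤ ε` for all non-degenerate `Ψ = (a_i n + b_i)_i` with `‖Ψ‖_N ≤ L`
(`bandSum_eq_sum_squarefree` + the uniform Euler tail `abs_sub_sum_squarefree_le`). [cite: Gallagher1976, Section 2] -/
theorem stub_singularSeriesBandlimited : ∀ θ : ℝ, 0 < θ → SingularSeriesBandlimited θ := by
  intro θ hθ t L _ ε hε
  obtain ⟨N₀, hN₀⟩ := abs_sub_sum_squarefree_le t L hθ hε
  obtain ⟨g, hg⟩ := exists_singSpec t
  refine ⟨N₀, fun N hN => ⟨g, fun Ψ hΨ hL => ?_⟩⟩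
  rw [bandSum_eq_sum_squarefree hg, sys_coeffs_consts Ψ]
  exact (hN₀ N hN Ψ hΨ hL).2

end Summit.Parity.GeneralizedHardyLittlewood.Cruxes.RelativeDimOne.GallagherBackwardsSplit

end
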